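import Summits.AtomisticToContinuum.Crystallization.Theorems.ExcessDecayLiouvillePhononStabilityFarDefs
import Summits.AtomisticToContinuum.Crystallization.Theorems.ExcessDecayLiouvillePhononStabilityPullback

/-!
# `PhononStability` (stmt-AtomisticToContinuum-9333), line `contragredient-window-collapse`: stub `stub_pathBound`

Far-field obligation S7 of the reshaped line (`PathBound`, vocabulary file
`ExcessDecayLiouvillePhononStabilityFarDefs.lean`): classes of reference length beyond the certificate range are
charged to the plain nearest-neighbour form `N0 w = Σ_{s ∈ nn} Σ_k ‖Δ_s w k‖²` through an explicit
NEAREST-NEIGHBOUR PATH.  Granted the chain bound S6 (`ChainBound`, weighted Cauchy–Schwarz along a chain), for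
every class `c = (m, m', n)` and every finitely supported label field `w`,
`plainForm c w = Σ_k ‖Δ_c w k‖² ≤ pathConst c · N0 w`,
`pathConst c = (2|n 2| + |n 0| + |n 1| + 1) · (max (max |n 0| |n 1|) |n 2| + 1)`:

* the canonical path (`exists_path`, assembled from the pieces of `concrete_steps`; a chain in the sense of
  `IsChain` with every step in `nnClasses`): `|n 2|` vertical double steps returning to the start sublattice
  (from `0` upward `(0,1,[0,0,0]) (1,0,[0,0,1])`, downward `(0,1,[0,0,-1]) (1,0,[0,0,0])`; from `1` upward
  `(1,0,[0,0,1]) (0,1,[0,0,0])`, downward `(1,0,[0,0,0]) (0,1,[0,0,-1])`), then `|n 0|` steps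
  `(m, m, ±[1,0,0])`, `|n 1|` steps `(m, m, ±[0,1,0])`, then one inter step `(m, m', [0,0,0])` if `m ≠ m'`;
  `chainEnd` of an append / of the replicated pieces by induction on the counts;
* its length is `L = 2|n 2| + |n 0| + |n 1| + [m ≠ m']`, and for `f ≥ 0` the sum of `f` along the path is at most
  `(max (max |n 0| |n 1|) |n 2| + 1) · Σ_{s ∈ nn} f s` (the four repeated step classes are pairwise distinct
  nearest-neighbour classes, the final step is one more);
* `‖x‖² = Σ_i ⟪e_i, x⟫²`, so `plainForm = Σ_i dirForm e_i` over the three coordinate directions, and the chain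
  bound with unit weights gives `plainForm c w ≤ L · Σ_{s ∈ path} plainForm s w ≤ pathConst c · N0 w`.

All `[folklore]`.
-/

noncomputable section

open scoped BigOperators Classical InnerProductSpace
open Filter Set Function
open Literature.MathematicalPhysics.StatisticalMechanics
open Summit.AtomisticToContinuum.Crystallization.Theses.ExcessDecayLiouville
open Summit.AtomisticToContinuum.Crystallization.Theorems.PhononStabilityNegative
open Summit.AtomisticToContinuum.Crystallization.Theorems.PhononStabilityCWC

namespace Summit.AtomisticToContinuum.Crystallization.Theorems.PhononStabilityCWC.PathBoundStub

/-! ## Composition of chains -/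

/-- `chainEnd` of a concatenation of two composable chains. [folklore] -/
theorem chainEnd_append {m m₁ m₂ : Fin 2} {n₁ n₂ : Fin 3 → ℤ} {l₁ l₂ : List BondClass}
    (h₁ : chainEnd m l₁ = some (m₁, n₁)) (h₂ : chainEnd m₁ l₂ = some (m₂, n₂)) :
    chainEnd m (l₁ ++ l₂) = some (m₂, n₁ + n₂) := by
  induction l₁ generalizing m n₁ with
  | nil =>
    simp only [chainEnd, Option.some.injEq, Prod.mk.injEq] at h₁
    obtain ⟨rfl, rfl⟩ := h₁
    simpa using h₂
  | cons s rest ih =>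
    simp only [List.cons_append, chainEnd] at h₁ ⊢
    by_cases hs : s.1 = m
    · rw [if_pos hs] at h₁ ⊢
      obtain ⟨⟨m', n'⟩, hp, hpe⟩ := Option.map_eq_some_iff.mp h₁
      simp only [Prod.mk.injEq] at hpe
      obtain ⟨rfl, rfl⟩ := hpe
      rw [ih hp]
      simp [add_assoc]
    · rw [if_neg hs] at h₁
      exact absurd h₁ (by simp)

/-- `k` copies of a closed piece `p` (from `m` back to `m`, net displacement `d`) compose to `(m, k • d)`.
[folklore] -/
theorem chainEnd_flatten_replicate {m : Fin 2} {p : List BondClass} {d : Fin 3 → ℤ}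
    (h : chainEnd m p = some (m, d)) (k : ℕ) :
    chainEnd m (List.replicate k p).flatten = some (m, (k : ℤ) • d) := by
  induction k with
  | zero => simp [chainEnd]
  | succ k ih =>
    rw [List.replicate_succ, List.flatten_cons, chainEnd_append h ih]
    congr 2
    push_cast
    rw [add_smul, one_smul, add_comm]

/-- `k` copies of an in-plane step `(m, m, d)` compose to `(m, k • d)`. [folklore] -/
theorem chainEnd_replicate (m : Fin 2) (d : Fin 3 → ℤ) (k : ℕ) :
    chainEnd m (List.replicate k (m, m, d)) = some (m, (k : ℤ) • d) := by
  induction k with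
  | zero => simp [chainEnd]
  | succ k ih =>
    rw [List.replicate_succ]
    simp only [chainEnd, if_true, ih, Option.map_some]
    congr 2
    push_cast
    rw [add_smul, one_smul, add_comm]

/-! ## A path assembled from abstract pieces

The path of a class is `k2` copies of a closed two-step piece `[x, y]` (net displacement `d2`), then `k0` in-plane
steps `(m, m, d0)`, `k1` in-plane steps `(m, m, d1)`, then a final piece `D` of length `≤ 1` ending on the target
sublattice; the concrete nearest-neighbour pieces are supplied by `concrete_steps` below. -/

/-- **Composition of the assembled path:** it ends at `(m', k2·d2 + k0·d0 + k1·d1)`. [folklore] -/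
theorem chainEnd_path {m m' : Fin 2} {x y : BondClass} {d2 : Fin 3 → ℤ} (d0 d1 : Fin 3 → ℤ)
    {D : List BondClass} (hv : chainEnd m [x, y] = some (m, d2)) (hD : chainEnd m D = some (m', 0))
    (k2 k0 k1 : ℕ) :
    chainEnd m ((List.replicate k2 [x, y]).flatten ++
        (List.replicate k0 (m, m, d0) ++ (List.replicate k1 (m, m, d1) ++ D))) =
      some (m', (k2 : ℤ) • d2 + ((k0 : ℤ) • d0 + ((k1 : ℤ) • d1 + 0))) :=
  chainEnd_append (chainEnd_flatten_replicate hv k2)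
    (chainEnd_append (chainEnd_replicate m d0 k0) (chainEnd_append (chainEnd_replicate m d1 k1) hD))

/-- Length of `k` copies of a piece. [folklore] -/
theorem length_flatten_replicate (p : List BondClass) (k : ℕ) :
    (List.replicate k p).flatten.length = k * p.length := by
  induction k with
  | zero => simp
  | succ k ih =>
    rw [List.replicate_succ, List.flatten_cons, List.length_append, ih]
    ring

/-- **Length of the assembled path:** `≤ 2 k2 + k0 + k1 + 1`. [folklore] -/
theorem length_path_le (x y b0 b1 : BondClass) {D : List BondClass} (hD : D.length ≤ 1) (k2 k0 k1 : ℕ) :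
    ((List.replicate k2 [x, y]).flatten ++ (List.replicate k0 b0 ++ (List.replicate k1 b1 ++ D))).length ≤
      2 * k2 + k0 + k1 + 1 := by
  simp only [List.length_append, length_flatten_replicate, List.length_replicate, List.length_cons,
    List.length_nil]
  omega

/-- Sum of a function along `k` copies of a piece. [folklore] -/
theorem sum_flatten_replicate (p : List BondClass) (f : BondClass → ℝ) (k : ℕ) :
    ((List.replicate k p).flatten.map f).sum = k * (p.map f).sum := by
  induction k with
  | zero => simp
  | succ k ih =>
    rw [List.replicate_succ, List.flatten_cons, List.map_append, List.sum_append, ih]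
    push_cast
    ring

/-- **Class multiplicities along the assembled path:** if the four repeated step classes `x, y, b0, b1` are
pairwise distinct nearest-neighbour classes and the final piece consists of at most one nearest-neighbour class,
then for `f ≥ 0`, `Σ_{s ∈ path} f s ≤ (max (max k0 k1) k2 + 1) · Σ_{s ∈ nn} f s`. [folklore] -/
theorem sum_map_path_le {x y b0 b1 : BondClass} {D : List BondClass} (hx : x ∈ nnClasses)
    (hy : y ∈ nnClasses) (hb0 : b0 ∈ nnClasses) (hb1 : b1 ∈ nnClasses) (hnd : [x, y, b0, b1].Nodup)
    (hDl : D.length ≤ 1) (hDm : ∀ s ∈ D, s ∈ nnClasses) (k2 k0 k1 : ℕ) (f : BondClass → ℝ)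
    (hf : ∀ s, 0 ≤ f s) :
    (((List.replicate k2 [x, y]).flatten ++ (List.replicate k0 b0 ++ (List.replicate k1 b1 ++ D))).map
        f).sum ≤ ((max (max k0 k1) k2 + 1 : ℕ) : ℝ) * ∑ s ∈ nnClasses, f s := by
  set S := ∑ s ∈ nnClasses, f s with hS_def
  have hS0 : 0 ≤ S := Finset.sum_nonneg fun s _ => hf s
  have hD : (D.map f).sum ≤ S := by
    rcases D with _ | ⟨d, _ | ⟨d', D'⟩⟩
    · simpa using hS0
    · simpa using Finset.single_le_sum (f := f) (fun s _ => hf s) (hDm d (by simp))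
    · exact absurd hDl (by simp)
  have hS4 : f x + f y + f b0 + f b1 ≤ S := by
    have hsub : [x, y, b0, b1].toFinset ⊆ nnClasses := by
      intro s hs
      simp only [List.mem_toFinset, List.mem_cons, List.not_mem_nil, or_false] at hs
      rcases hs with rfl | rfl | rfl | rfl
      exacts [hx, hy, hb0, hb1]
    calc f x + f y + f b0 + f b1 = ([x, y, b0, b1].map f).sum := by simp [add_assoc]
      _ = ∑ s ∈ [x, y, b0, b1].toFinset, f s := (List.sum_toFinset f hnd).symm
      _ ≤ S := Finset.sum_le_sum_of_subset_of_nonneg hsub fun s _ _ => hf s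
  have h0 := hf x
  have h1 := hf y
  have h2 := hf b0
  have h3 := hf b1
  set M : ℕ := max (max k0 k1) k2 with hM_def
  have hk2 : (k2 : ℝ) ≤ M := by exact_mod_cast le_max_right _ _
  have hk0 : (k0 : ℝ) ≤ M := by exact_mod_cast (le_max_left k0 k1).trans (le_max_left _ _)
  have hk1 : (k1 : ℝ) ≤ M := by exact_mod_cast (le_max_right k0 k1).trans (le_max_left _ _)
  have hM0 : (0 : ℝ) ≤ M := Nat.cast_nonneg _
  rw [List.map_append, List.sum_append, List.map_append, List.sum_append, List.map_append,
    List.sum_append, sum_flatten_replicate, List.map_replicate, List.sum_replicate, List.map_replicate,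
    List.sum_replicate, nsmul_eq_mul, nsmul_eq_mul]
  simp only [List.map_cons, List.map_nil, List.sum_cons, List.sum_nil, add_zero]
  push_cast
  nlinarith [mul_le_mul_of_nonneg_right hk2 (add_nonneg h0 h1), mul_le_mul_of_nonneg_right hk0 h2,
    mul_le_mul_of_nonneg_right hk1 h3, mul_le_mul_of_nonneg_left hS4 hM0, hD]

/-! ## The concrete nearest-neighbour pieces -/

/-- **The nearest-neighbour pieces** of the canonical path from sublattice `m` (signs encoded by `Bool`s): the
vertical double step `x, y` (from `0` upward `(0,1,[0,0,0]) (1,0,[0,0,1])`, downward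
`(0,1,[0,0,-1]) (1,0,[0,0,0])`; from `1` upward `(1,0,[0,0,1]) (0,1,[0,0,0])`, downward
`(1,0,[0,0,0]) (0,1,[0,0,-1])`) returns to `m` with net displacement `d2 = ±[0,0,1]`; the in-plane steps
`(m, m, d0 = ±[1,0,0])`, `(m, m, d1 = ±[0,1,0])`; the final inter step `(m, m', [0,0,0])` if `m ≠ m'`.  All are
nearest-neighbour classes and the four repeated ones are pairwise distinct (finite check). [folklore] -/
theorem concrete_steps (m m' : Fin 2) (u2 u0 u1 : Bool) (x y : BondClass) (d2 d0 d1 : Fin 3 → ℤ)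
    (D : List BondClass)
    (hx : x = (m, m + 1, ite (m = 0) (cond u2 ![0, 0, 0] ![0, 0, -1]) (cond u2 ![0, 0, 1] ![0, 0, 0])))
    (hy : y = (m + 1, m, ite (m = 0) (cond u2 ![0, 0, 1] ![0, 0, 0]) (cond u2 ![0, 0, 0] ![0, 0, -1])))
    (hd2 : d2 = cond u2 ![0, 0, 1] ![0, 0, -1]) (hd0 : d0 = cond u0 ![1, 0, 0] ![-1, 0, 0])
    (hd1 : d1 = cond u1 ![0, 1, 0] ![0, -1, 0]) (hD : D = ite (m = m') [] [(m, m', ![0, 0, 0])]) :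
    chainEnd m [x, y] = some (m, d2) ∧ chainEnd m D = some (m', 0) ∧ D.length ≤ 1 ∧
      (∀ s ∈ D, s ∈ nnClasses) ∧ x ∈ nnClasses ∧ y ∈ nnClasses ∧ ((m, m, d0) : BondClass) ∈ nnClasses ∧
        ((m, m, d1) : BondClass) ∈ nnClasses ∧ [x, y, (m, m, d0), (m, m, d1)].Nodup := by
  subst hx hy hd2 hd0 hd1 hD
  refine ⟨?_, ?_, ?_, ?_, ?_, ?_, ?_, ?_, ?_⟩ <;> revert m m' u2 u0 u1 <;> decide

/-- **The canonical path with abstract signs and counts:** a chain from `m` to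
`(m', k2·(±[0,0,1]) + k0·(±[1,0,0]) + k1·(±[0,1,0]))` of length `≤ 2 k2 + k0 + k1 + 1` along which every
`f ≥ 0` sums to at most `(max (max k0 k1) k2 + 1) · Σ_{s ∈ nn} f s`. [folklore] -/
theorem path_props (m m' : Fin 2) (u2 u0 u1 : Bool) (k2 k0 k1 : ℕ) :
    ∃ l : List BondClass,
      chainEnd m l = some (m', (k2 : ℤ) • (cond u2 ![0, 0, 1] ![0, 0, -1] : Fin 3 → ℤ) +
        ((k0 : ℤ) • (cond u0 ![1, 0, 0] ![-1, 0, 0] : Fin 3 → ℤ) +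
          ((k1 : ℤ) • (cond u1 ![0, 1, 0] ![0, -1, 0] : Fin 3 → ℤ) + 0))) ∧
      l.length ≤ 2 * k2 + k0 + k1 + 1 ∧
      ∀ f : BondClass → ℝ, (∀ s, 0 ≤ f s) →
        (l.map f).sum ≤ ((max (max k0 k1) k2 + 1 : ℕ) : ℝ) * ∑ s ∈ nnClasses, f s := by
  obtain ⟨hv, hDc, hDl, hDm, hxm, hym, hb0m, hb1m, hnd⟩ :=
    concrete_steps m m' u2 u0 u1 _ _ _ _ _ _ rfl rfl rfl rfl rfl rfl
  exact ⟨_, chainEnd_path _ _ hv hDc k2 k0 k1, length_path_le _ _ _ _ hDl k2 k0 k1,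
    fun f hf => sum_map_path_le hxm hym hb0m hb1m hnd hDl hDm k2 k0 k1 f hf⟩

/-- Coordinates of the net vertical displacement `±[0,0,1]`. [folklore] -/
theorem vu_apply (u : Bool) :
    (cond u ![0, 0, 1] ![0, 0, -1] : Fin 3 → ℤ) 0 = 0 ∧ (cond u ![0, 0, 1] ![0, 0, -1] : Fin 3 → ℤ) 1 = 0 ∧
      (cond u ![0, 0, 1] ![0, 0, -1] : Fin 3 → ℤ) 2 = cond u 1 (-1) := by
  cases u <;> exact ⟨rfl, rfl, rfl⟩

/-- Coordinates of the in-plane displacement `±[1,0,0]`. [folklore] -/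
theorem hu0_apply (u : Bool) :
    (cond u ![1, 0, 0] ![-1, 0, 0] : Fin 3 → ℤ) 0 = cond u 1 (-1) ∧
      (cond u ![1, 0, 0] ![-1, 0, 0] : Fin 3 → ℤ) 1 = 0 ∧ (cond u ![1, 0, 0] ![-1, 0, 0] : Fin 3 → ℤ) 2 = 0 := by
  cases u <;> exact ⟨rfl, rfl, rfl⟩

/-- Coordinates of the in-plane displacement `±[0,1,0]`. [folklore] -/
theorem hu1_apply (u : Bool) :
    (cond u ![0, 1, 0] ![0, -1, 0] : Fin 3 → ℤ) 0 = 0 ∧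
      (cond u ![0, 1, 0] ![0, -1, 0] : Fin 3 → ℤ) 1 = cond u 1 (-1) ∧ (cond u ![0, 1, 0] ![0, -1, 0] : Fin 3 → ℤ) 2 = 0 := by
  cases u <;> exact ⟨rfl, rfl, rfl⟩

/-- `|a| · sign(a) = a` in the `Bool` encoding of the sign. [folklore] -/
theorem natAbs_mul_cond (a : ℤ) : (a.natAbs : ℤ) * cond (decide (0 ≤ a)) 1 (-1) = a := by
  by_cases ha : 0 ≤ a
  · simp [ha, abs_of_nonneg ha]
  · simp [ha, abs_of_neg (not_le.mp ha)]

/-- **The canonical nearest-neighbour path of a class** `c = (m, m', n)` (signs of `n i`, counts `|n i|`): a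
chain composing to `c`, of length `≤ 2|n 2| + |n 0| + |n 1| + 1`, along which every `f ≥ 0` sums to at most
`(max (max |n 0| |n 1|) |n 2| + 1) · Σ_{s ∈ nn} f s`. [folklore] -/
theorem exists_path (c : BondClass) : ∃ l : List BondClass, IsChain c l ∧
    ((l.length : ℝ) ≤ ((2 * |c.2.2 2| + |c.2.2 0| + |c.2.2 1| + 1 : ℤ) : ℝ)) ∧
    ∀ f : BondClass → ℝ, (∀ s, 0 ≤ f s) →
      (l.map f).sum ≤ ((max (max |c.2.2 0| |c.2.2 1|) |c.2.2 2| + 1 : ℤ) : ℝ) * ∑ s ∈ nnClasses, f s := by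
  obtain ⟨m, m', n⟩ := c
  obtain ⟨l, h1, h2, h3⟩ := path_props m m' (decide (0 ≤ n 2)) (decide (0 ≤ n 0)) (decide (0 ≤ n 1))
    (n 2).natAbs (n 0).natAbs (n 1).natAbs
  refine ⟨l, ?_, ?_, fun f hf => (h3 f hf).trans_eq ?_⟩
  · -- the chain composes to `(m', n)`
    unfold IsChain
    dsimp only
    rw [h1]
    congr 2
    obtain ⟨hv0, hv1, hv2⟩ := vu_apply (decide (0 ≤ n 2))
    obtain ⟨ha0, ha1, ha2⟩ := hu0_apply (decide (0 ≤ n 0))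
    obtain ⟨hb0, hb1, hb2⟩ := hu1_apply (decide (0 ≤ n 1))
    funext i
    fin_cases i
    · simp only [Fin.zero_eta, Pi.add_apply, Pi.smul_apply, smul_eq_mul, hv0, ha0, hb0,
        mul_zero, zero_add, add_zero, natAbs_mul_cond]
    · simp only [Fin.mk_one, Pi.add_apply, Pi.smul_apply, smul_eq_mul, hv1, ha1, hb1,
        mul_zero, zero_add, add_zero, natAbs_mul_cond]
    · have h2 : (⟨2, by norm_num⟩ : Fin 3) = 2 := rfl
      simp only [h2, Pi.add_apply, Pi.smul_apply, smul_eq_mul, hv2, ha2, hb2,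
        mul_zero, add_zero, natAbs_mul_cond]
  · -- length
    have h := (Nat.cast_le (α := ℤ)).mpr h2
    push_cast [Int.natCast_natAbs] at h
    exact_mod_cast h
  · -- the multiplicity constant
    push_cast [Nat.cast_natAbs, Nat.cast_max]
    ring

/-! ## Coordinate decomposition of the plain form -/

/-- `Σ_k ‖Δ_c w k‖² ≥ 0`; copy of the line's Basics lemma. [folklore] -/
private theorem plainForm_nonneg (c : BondClass) (w : Label → EuclideanSpace ℝ (Fin 3)) :
    0 ≤ plainForm c w :=
  tsum_nonneg fun _ => by positivity

/-- `‖x‖² = Σ_i ⟪e_i, x⟫²` in `ℝ³`. [folklore] -/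
theorem norm_sq_eq_sum_inner (x : EuclideanSpace ℝ (Fin 3)) :
    ‖x‖ ^ 2 = ∑ i, (inner ℝ (EuclideanSpace.single i (1 : ℝ)) x) ^ 2 := by
  rw [EuclideanSpace.real_norm_sq_eq]
  refine Finset.sum_congr rfl fun i _ => ?_
  rw [EuclideanSpace.inner_single_left]
  simp

/-- **`plainForm = Σ_i dirForm e_i`** for a finitely supported field (a `tsum` of a finite sum of finitely
supported families). [folklore] -/
theorem plainForm_eq_sum_dirForm {w : Label → EuclideanSpace ℝ (Fin 3)} (hw : (support w).Finite)
    (c : BondClass) : plainForm c w = ∑ i, dirForm (EuclideanSpace.single i (1 : ℝ)) c w := by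
  unfold plainForm dirForm
  rw [← Summable.tsum_finsetSum]
  · exact tsum_congr fun k => norm_sq_eq_sum_inner _
  · intro i _
    exact summable_of_hasFiniteSupport ((PullbackStub.finite_support_bondDiff hw c).subset
      fun k hk => by
        rw [mem_support] at hk ⊢
        contrapose! hk
        simp [hk])

/-! ## The stub -/

/-- **S7 — PATH BOUND** (`stub_pathBound`): for every class `c` and finitely supported `w`,
`Σ_k ‖Δ_c w k‖² ≤ pathConst c · N0 w`: the chain bound with unit weights along the canonical
nearest-neighbour path in each of the three coordinate directions (`‖x‖² = Σ_i ⟪e_i, x⟫²`), the path length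
`L ≤ 2|n 2| + |n 0| + |n 1| + 1` and the class multiplicities `≤ max (max |n 0| |n 1|) |n 2| + 1` along it.
[folklore] -/
theorem stub_pathBound : PathBound := by
  intro hCB c _ w hw
  obtain ⟨l, hch, hL, hsum⟩ := exists_path c
  -- the chain bound with unit weights, per coordinate direction
  have hdir : ∀ i : Fin 3, dirForm (EuclideanSpace.single i (1 : ℝ)) c w ≤
      (l.length : ℝ) * (l.map fun s => dirForm (EuclideanSpace.single i (1 : ℝ)) s w).sum := by
    intro i
    have h := hCB c l hch (fun _ => 1) (fun _ _ => one_pos) (EuclideanSpace.single i (1 : ℝ)) w hw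
    simpa using h
  have hN0 : 0 ≤ N0 w := Finset.sum_nonneg fun s _ => plainForm_nonneg s w
  have hle := hsum (fun s => plainForm s w) fun s => plainForm_nonneg s w
  have hM : (0 : ℝ) ≤ ((max (max |c.2.2 0| |c.2.2 1|) |c.2.2 2| + 1 : ℤ) : ℝ) := by
    exact_mod_cast add_nonneg ((abs_nonneg _).trans (le_max_right _ _)) zero_le_one
  set L : ℝ := (l.length : ℝ)
  calc plainForm c w = ∑ i, dirForm (EuclideanSpace.single i (1 : ℝ)) c w := plainForm_eq_sum_dirForm hw c
    _ ≤ ∑ i : Fin 3, L * (l.map fun s => dirForm (EuclideanSpace.single i (1 : ℝ)) s w).sum :=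
        Finset.sum_le_sum fun i _ => hdir i
    _ = L * (l.map fun s => ∑ i, dirForm (EuclideanSpace.single i (1 : ℝ)) s w).sum := by
        simp only [Fin.sum_univ_three, List.sum_map_add]
        ring
    _ = L * (l.map fun s => plainForm s w).sum := by
        congr 1
        exact congrArg List.sum (List.map_congr_left fun s _ => (plainForm_eq_sum_dirForm hw s).symm)
    _ ≤ L * (((max (max |c.2.2 0| |c.2.2 1|) |c.2.2 2| + 1 : ℤ) : ℝ) * N0 w) :=
        mul_le_mul_of_nonneg_left hle (Nat.cast_nonneg _)
    _ ≤ ((2 * |c.2.2 2| + |c.2.2 0| + |c.2.2 1| + 1 : ℤ) : ℝ) *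
          (((max (max |c.2.2 0| |c.2.2 1|) |c.2.2 2| + 1 : ℤ) : ℝ) * N0 w) :=
        mul_le_mul_of_nonneg_right hL (mul_nonneg hM hN0)
    _ = pathConst c * N0 w := by rw [pathConst, mul_assoc]

end Summit.AtomisticToContinuum.Crystallization.Theorems.PhononStabilityCWC.PathBoundStub

end
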